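import Summits.AtomisticToContinuum.HydrodynamicLimit.Theorems.EnskogAdjointDualityEquilibriumCollisionResidualKernelSymmetry
import Summits.AtomisticToContinuum.HydrodynamicLimit.Theorems.EnskogAdjointDualityDualityReductionMaxwellian
import HarnessLib

/-!
# EnskogAdjointDuality / AdjointEnskogTestFamilyR — stub B3a helper 1: Gaussian projection moments

Support lemmas for the Gaussian pair integrals of the collisional transfer (stub `stub_pairGaussian`
of the birth line of `Summit.AtomisticToContinuum.HydrodynamicLimit.Theses.EnskogAdjointDuality.AdjointEnskogTestFamilyR`,
stmt-AtomisticToContinuum-11592). Everything lives on `V3 = ℝ³` with `M = M_{1,θ,u}` the local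
Maxwellian of unit density (the Lebesgue density of `gaussMeasure u θ = N(u, θ id)`):

* `k2r_integrable_weight_mul_localMaxwellian_prod` — `W(v,w) M_{θ,u}(v) M_{θ',u'}(w)` is integrable on
  `ℝ³ × ℝ³` for polynomially bounded measurable weights (two different Maxwellians);
* `k2r_integral_inner_stdGaussian`, `k2r_integral_inner_sq_stdGaussian` — the projection `z ↦ ⟪z, ω⟫`
  of the standard Gaussian is centred with second moment `‖ω‖²`;
* `k2r_integral_localMaxwellian_mul_quadratic` —
  `∫ M_{θ,u}(w) (a + b ⟪w − u, ω⟫ + c ⟪w − u, ω⟫²) dw = a + c θ ‖ω‖²`;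
* `k2r_integral_weight_mul_localMaxwellian_pair` — the inner `w`-integral of a pair integrand through the
  coupling `w = u' + √θ' z`, `z ∼ stdGaussian`;
* elementary facts on the kernel `q ↦ q₊ q` (`q₊ q + (−q)₊ (−q) = q²`, local Lipschitz bound).

References: C. Cercignani, R. Illner, M. Pulvirenti, *The Mathematical Theory of Dilute Gases* (1994),
§3.1 [CIP1994]; S. Chapman, T. G. Cowling, *The Mathematical Theory of Non-uniform Gases* (1970), §16
[ChapmanCowling1970].
-/

noncomputable section

open MeasureTheory ProbabilityTheory Metric Set Filter Topology Function
open scoped InnerProductSpace ENNReal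

namespace Summit.AtomisticToContinuum.HydrodynamicLimit.Theorems.EnskogAdjointDuality

open Literature.Analysis.FluidPDE Literature.MathematicalPhysics.KineticTheory

/-! ## Elementary facts on the kernel `q ↦ q₊ q` -/

/-- `q₊ q + (−q)₊ (−q) = q²`. [folklore] -/
theorem k2r_posMul_add_posMul_neg (q : ℝ) : max q 0 * q + max (-q) 0 * (-q) = q ^ 2 := by
  rcases le_total 0 q with hq | hq
  · rw [max_eq_left hq, max_eq_right (neg_nonpos.2 hq)]; ring
  · rw [max_eq_right hq, max_eq_left (neg_nonneg.2 hq)]; ring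

/-- `|q₊ q| ≤ q²`. [folklore] -/
theorem k2r_abs_posMul_le (q : ℝ) : |max q 0 * q| ≤ q ^ 2 := by
  rcases le_total 0 q with hq | hq
  · rw [max_eq_left hq, abs_of_nonneg (mul_nonneg hq hq)]; ring_nf; rfl
  · rw [max_eq_right hq, zero_mul, abs_zero]; positivity

/-- The kernel `q ↦ q₊ q` is locally Lipschitz: `|a₊ a − b₊ b| ≤ (|a| + |b|) |a − b|`. [folklore] -/
theorem k2r_abs_posMul_sub_posMul_le (a b : ℝ) :
    |max a 0 * a - max b 0 * b| ≤ (|a| + |b|) * |a - b| := by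
  rcases le_total 0 a with ha | ha <;> rcases le_total 0 b with hb | hb
  · rw [max_eq_left ha, max_eq_left hb, abs_of_nonneg ha, abs_of_nonneg hb,
      show a * a - b * b = (a + b) * (a - b) by ring, abs_mul, abs_of_nonneg (add_nonneg ha hb)]
  · rw [max_eq_left ha, max_eq_right hb, abs_of_nonneg ha, abs_of_nonpos hb, zero_mul, sub_zero,
      abs_of_nonneg (mul_nonneg ha ha), abs_of_nonneg (by linarith : 0 ≤ a - b)]
    nlinarith
  · rw [max_eq_right ha, max_eq_left hb, abs_of_nonpos ha, abs_of_nonneg hb, zero_mul, zero_sub,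
      abs_neg, abs_of_nonneg (mul_nonneg hb hb), abs_of_nonpos (by linarith : a - b ≤ 0)]
    nlinarith
  · rw [max_eq_right ha, max_eq_right hb, zero_mul, zero_mul, sub_zero, abs_zero]
    positivity

/-- `|⟪v − w, ω⟫| ≤ (1 + ‖v‖)(1 + ‖w‖)` for a unit vector `ω`. [folklore] -/
theorem k2r_abs_inner_sub_le (v w ω : V3) (hω : ‖ω‖ = 1) :
    |⟪v - w, ω⟫_ℝ| ≤ (1 + ‖v‖) * (1 + ‖w‖) := by
  calc |⟪v - w, ω⟫_ℝ| ≤ ‖v - w‖ * ‖ω‖ := abs_real_inner_le_norm _ _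
    _ ≤ (‖v‖ + ‖w‖) * 1 := by rw [hω]; exact mul_le_mul_of_nonneg_right (norm_sub_le v w) zero_le_one
    _ ≤ (1 + ‖v‖) * (1 + ‖w‖) := by nlinarith [norm_nonneg v, norm_nonneg w]

/-- `|⟪v + w, ω⟫| ≤ (1 + ‖v‖)(1 + ‖w‖)` for a unit vector `ω`. [folklore] -/
theorem k2r_abs_inner_add_le (v w ω : V3) (hω : ‖ω‖ = 1) :
    |⟪v + w, ω⟫_ℝ| ≤ (1 + ‖v‖) * (1 + ‖w‖) := by
  calc |⟪v + w, ω⟫_ℝ| ≤ ‖v + w‖ * ‖ω‖ := abs_real_inner_le_norm _ _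
    _ ≤ (‖v‖ + ‖w‖) * 1 := by rw [hω]; exact mul_le_mul_of_nonneg_right (norm_add_le v w) zero_le_one
    _ ≤ (1 + ‖v‖) * (1 + ‖w‖) := by nlinarith [norm_nonneg v, norm_nonneg w]

/-- Reflection through the drift leaves the local Maxwellian invariant: `M_{θ,u}(2u − v) = M_{θ,u}(v)`.
[folklore] -/
theorem k2r_localMaxwellian_two_smul_sub (θ : ℝ) (u v : V3) :
    localMaxwellian 1 θ u ((2 : ℝ) • u - v) = localMaxwellian 1 θ u v := by
  simp only [localMaxwellian]
  rw [show (2 : ℝ) • u - v - u = -(v - u) by module, norm_neg]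

/-! ## Integrability of Maxwellian-weighted pair integrands -/

/-- **Domination of two-Maxwellian pair integrands.** For `θ, θ' > 0` and an a.e.-strongly measurable
weight `|W(v, w)| ≤ C ((1 + ‖v‖)(1 + ‖w‖))ᵐ`, the integrand `W(v,w) M_{θ,u}(v) M_{θ',u'}(w)` is integrable
on `ℝ³ × ℝ³` (dominated by `|C| ρ(v) ρ'(w)` with `ρ = (1 + ‖·‖)ᵐ M ∈ L¹`). [folklore] -/
theorem k2r_integrable_weight_mul_localMaxwellian_prod {θ θ' : ℝ} (hθ : 0 < θ) (hθ' : 0 < θ')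
    (u u' : V3) {W : V3 × V3 → ℝ} (hWm : AEStronglyMeasurable W ((volume : Measure V3).prod volume))
    {C : ℝ} {m : ℕ} (hW : ∀ p, |W p| ≤ C * ((1 + ‖p.1‖) * (1 + ‖p.2‖)) ^ m) :
    Integrable (fun p : V3 × V3 => W p * (localMaxwellian 1 θ u p.1 * localMaxwellian 1 θ' u' p.2))
      ((volume : Measure V3).prod volume) := by
  set ρ : V3 → ℝ := fun v => (1 + ‖v‖) ^ m * localMaxwellian 1 θ u v with hρ
  set ρ' : V3 → ℝ := fun v => (1 + ‖v‖) ^ m * localMaxwellian 1 θ' u' v with hρ'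
  have hρi : Integrable ρ := integrable_one_add_norm_pow_mul_localMaxwellian hθ u m
  have hρi' : Integrable ρ' := integrable_one_add_norm_pow_mul_localMaxwellian hθ' u' m
  have hdom : Integrable (fun p : V3 × V3 => |C| * (ρ p.1 * ρ' p.2))
      ((volume : Measure V3).prod volume) :=
    (hρi.mul_prod hρi').const_mul _
  refine hdom.mono' ?_ (Eventually.of_forall fun p => ?_)
  · have hM : Continuous fun p : V3 × V3 =>
        localMaxwellian 1 θ u p.1 * localMaxwellian 1 θ' u' p.2 := by
      have h1 := continuous_localMaxwellian (E := V3) 1 θ u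
      have h2 := continuous_localMaxwellian (E := V3) 1 θ' u'
      fun_prop
    exact hWm.mul hM.aestronglyMeasurable
  obtain ⟨v, w⟩ := p
  have hMv := localMaxwellian_nonneg zero_le_one hθ.le u v
  have hMw := localMaxwellian_nonneg zero_le_one hθ'.le u' w
  rw [Real.norm_eq_abs, abs_mul, abs_mul, abs_of_nonneg hMv, abs_of_nonneg hMw]
  have hWX : |W (v, w)| ≤ |C| * ((1 + ‖v‖) * (1 + ‖w‖)) ^ m :=
    (hW (v, w)).trans (mul_le_mul_of_nonneg_right (le_abs_self _) (by positivity))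
  calc |W (v, w)| * (localMaxwellian 1 θ u v * localMaxwellian 1 θ' u' w)
      ≤ |C| * ((1 + ‖v‖) * (1 + ‖w‖)) ^ m * (localMaxwellian 1 θ u v * localMaxwellian 1 θ' u' w) :=
        mul_le_mul_of_nonneg_right hWX (mul_nonneg hMv hMw)
    _ = |C| * (ρ v * ρ' w) := by simp only [hρ, hρ', mul_pow]; ring

/-! ## Projection moments of the standard Gaussian -/

/-- Pairing with the local Maxwellian is integration of `g(u + √θ z)` against the standard Gaussian.
[folklore]

This is the scalar case `F := ℝ` of
`Literature.MathematicalPhysics.KineticTheory.integral_localMaxwellian_smul` (`HardSphereEulerProofs.lean`),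
with `•` unfolded to `*` (dedup-03062).  The name is kept (not deprecated) because the `*`-form is
what the `rw` call sites below match syntactically. -/
theorem k2r_integral_localMaxwellian_mul_eq_stdGaussian {θ : ℝ} (hθ : 0 < θ) (u : V3) (g : V3 → ℝ) :
    ∫ v, localMaxwellian 1 θ u v * g v = ∫ z, g (u + Real.sqrt θ • z) ∂stdGaussian V3 :=
  integral_localMaxwellian_smul hθ u g

/-- The projection `z ↦ ⟪z, ω⟫` is in every `L^p` of the standard Gaussian. [folklore] -/
theorem k2r_memLp_inner_stdGaussian (ω : V3) (p : ℝ≥0∞) (hp : p ≠ ∞) :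
    MemLp (fun z : V3 => ⟪z, ω⟫_ℝ) p (stdGaussian V3) := by
  have h := IsGaussian.memLp_dual (stdGaussian V3) (innerSL ℝ ω) p hp
  have hfun : (fun z : V3 => ⟪z, ω⟫_ℝ) = ⇑(innerSL ℝ ω) := by
    funext z
    rw [coe_innerSL_apply, real_inner_comm]
  rw [hfun]
  exact h

/-- The projection of the standard Gaussian is centred: `∫ ⟪z, ω⟫ dγ(z) = 0`. [folklore] -/
theorem k2r_integral_inner_stdGaussian (ω : V3) : ∫ z, ⟪z, ω⟫_ℝ ∂stdGaussian V3 = 0 := by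
  have h := integral_strongDual_stdGaussian (E := V3) (innerSL ℝ ω)
  have hfun : (fun z : V3 => ⟪z, ω⟫_ℝ) = ⇑(innerSL ℝ ω) := by
    funext z
    rw [coe_innerSL_apply, real_inner_comm]
  rw [hfun]
  exact h

/-- Second moment of the projection of the standard Gaussian: `∫ ⟪z, ω⟫² dγ(z) = ‖ω‖²`. [folklore] -/
theorem k2r_integral_inner_sq_stdGaussian (ω : V3) :
    ∫ z, ⟪z, ω⟫_ℝ ^ 2 ∂stdGaussian V3 = ‖ω‖ ^ 2 := by
  have hmem : MemLp (fun z : V3 => ⟪z, ω⟫_ℝ) 2 (stdGaussian V3) :=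
    k2r_memLp_inner_stdGaussian ω 2 (by simp)
  have hvar : Var[fun z : V3 => ⟪z, ω⟫_ℝ; stdGaussian V3] = ‖ω‖ ^ 2 := by
    have h := variance_dual_stdGaussian (E := V3) (innerSL ℝ ω)
    rw [innerSL_apply_norm] at h
    have hfun : (fun z : V3 => ⟪z, ω⟫_ℝ) = ⇑(innerSL ℝ ω) := by
      funext z
      rw [coe_innerSL_apply, real_inner_comm]
    rw [hfun]
    exact h
  have h := variance_eq_sub hmem
  rw [hvar, k2r_integral_inner_stdGaussian] at h
  simp only [ne_eq, OfNat.ofNat_ne_zero, not_false_eq_true, zero_pow, sub_zero] at h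
  rw [h]
  rfl

/-- `(1 + ‖z‖)ⁿ` is integrable under the standard Gaussian (Fernique). [folklore] -/
theorem k2r_integrable_one_add_norm_pow_stdGaussian (n : ℕ) :
    Integrable (fun z : V3 => (1 + ‖z‖) ^ n) (stdGaussian V3) := by
  have h0 : MemLp (fun z : V3 => ‖z‖) (n : ℝ≥0∞) (stdGaussian V3) :=
    (IsGaussian.memLp_id (stdGaussian V3) n (ENNReal.natCast_ne_top n)).norm
  have h1 : MemLp (fun z : V3 => 1 + ‖z‖) (n : ℝ≥0∞) (stdGaussian V3) :=
    (memLp_const (1 : ℝ)).add h0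
  refine h1.integrable_norm_pow'.congr (ae_of_all _ fun z => ?_)
  change ‖1 + ‖z‖‖ ^ n = (1 + ‖z‖) ^ n
  rw [Real.norm_of_nonneg (by positivity)]

/-- **Quadratic projection moments of the local Maxwellian**:
`∫ M_{θ,u}(w) (a + b ⟪w − u, ω⟫ + c ⟪w − u, ω⟫²) dw = a + c θ ‖ω‖²` (`θ > 0`). [folklore] -/
theorem k2r_integral_localMaxwellian_mul_quadratic {θ : ℝ} (hθ : 0 < θ) (u ω : V3) (a b c : ℝ) :
    ∫ w, localMaxwellian 1 θ u w * (a + b * ⟪w - u, ω⟫_ℝ + c * ⟪w - u, ω⟫_ℝ ^ 2) =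
      a + c * θ * ‖ω‖ ^ 2 := by
  rw [k2r_integral_localMaxwellian_mul_eq_stdGaussian hθ]
  have hX : Integrable (fun z : V3 => ⟪z, ω⟫_ℝ) (stdGaussian V3) :=
    (k2r_memLp_inner_stdGaussian ω 1 (by simp)).integrable le_rfl
  have hX2 : Integrable (fun z : V3 => ⟪z, ω⟫_ℝ ^ 2) (stdGaussian V3) :=
    (k2r_memLp_inner_stdGaussian ω 2 (by simp)).integrable_sq
  have hpt : ∀ z : V3, a + b * ⟪u + Real.sqrt θ • z - u, ω⟫_ℝ + c * ⟪u + Real.sqrt θ • z - u, ω⟫_ℝ ^ 2 =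
      a + b * Real.sqrt θ * ⟪z, ω⟫_ℝ + c * θ * ⟪z, ω⟫_ℝ ^ 2 := by
    intro z
    rw [add_sub_cancel_left, real_inner_smul_left, mul_pow, Real.sq_sqrt hθ.le]
    ring
  simp_rw [hpt]
  have h1 : Integrable (fun z : V3 => b * Real.sqrt θ * ⟪z, ω⟫_ℝ) (stdGaussian V3) := hX.const_mul _
  have h2 : Integrable (fun z : V3 => c * θ * ⟪z, ω⟫_ℝ ^ 2) (stdGaussian V3) := hX2.const_mul _
  have h3 : Integrable (fun z : V3 => a + b * Real.sqrt θ * ⟪z, ω⟫_ℝ) (stdGaussian V3) :=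
    (integrable_const a).add h1
  rw [integral_add h3 h2, integral_add (integrable_const a) h1, integral_const, integral_const_mul,
    integral_const_mul, k2r_integral_inner_stdGaussian, k2r_integral_inner_sq_stdGaussian,
    smul_eq_mul, probReal_univ]
  ring

/-- **The inner integral through the Gaussian coupling.** For fixed `v`,
`∫ k(w) M_{θ,u}(v) M_{θ',u'}(w) dw = M_{θ,u}(v) ∫ k(u' + √θ' z) dγ(z)` (`θ' > 0`). [folklore] -/
theorem k2r_integral_weight_mul_localMaxwellian_pair (θ : ℝ) {θ' : ℝ} (hθ' : 0 < θ') (u u' : V3)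
    (k : V3 → ℝ) (v : V3) :
    ∫ w, k w * (localMaxwellian 1 θ u v * localMaxwellian 1 θ' u' w) =
      localMaxwellian 1 θ u v * ∫ z, k (u' + Real.sqrt θ' • z) ∂stdGaussian V3 := by
  rw [← k2r_integral_localMaxwellian_mul_eq_stdGaussian hθ' u' k, ← integral_const_mul]
  refine integral_congr_ae (Eventually.of_forall fun w => ?_)
  ring

/-- Moments of the local Maxwellian through the coupling, with a uniform bound:
`∫ M_{θ,u}(v) (1 + ‖v‖)ⁿ dv ≤ (1 + |U| + √Θ)ⁿ ∫ (1 + ‖z‖)ⁿ dγ` for `‖u‖ ≤ U`, `0 < θ ≤ Θ`. [folklore] -/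
theorem k2r_integral_localMaxwellian_mul_one_add_norm_pow_le {θ Θ U : ℝ} (hθ : 0 < θ) (hθΘ : θ ≤ Θ)
    {u : V3} (hu : ‖u‖ ≤ U) (n : ℕ) :
    ∫ v, localMaxwellian 1 θ u v * (1 + ‖v‖) ^ n ≤
      (1 + |U| + Real.sqrt Θ) ^ n * ∫ z, (1 + ‖z‖) ^ n ∂stdGaussian V3 := by
  rw [k2r_integral_localMaxwellian_mul_eq_stdGaussian hθ u (fun v => (1 + ‖v‖) ^ n),
    ← integral_const_mul]
  have hpt : ∀ z : V3, (1 + ‖u + Real.sqrt θ • z‖) ^ n ≤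
      (1 + |U| + Real.sqrt Θ) ^ n * (1 + ‖z‖) ^ n := by
    intro z
    rw [← mul_pow]
    refine pow_le_pow_left₀ (by positivity) ?_ n
    have h1 : ‖u + Real.sqrt θ • z‖ ≤ |U| + Real.sqrt Θ * ‖z‖ := by
      calc ‖u + Real.sqrt θ • z‖ ≤ ‖u‖ + ‖Real.sqrt θ • z‖ := norm_add_le _ _
        _ = ‖u‖ + Real.sqrt θ * ‖z‖ := by
            rw [norm_smul, Real.norm_eq_abs, abs_of_nonneg (Real.sqrt_nonneg θ)]
        _ ≤ |U| + Real.sqrt Θ * ‖z‖ := by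
            gcongr
            · exact hu.trans (le_abs_self U)
    have hU : 0 ≤ |U| := abs_nonneg U
    have hS : 0 ≤ Real.sqrt Θ := Real.sqrt_nonneg Θ
    nlinarith [norm_nonneg z, mul_nonneg hU (norm_nonneg z), mul_nonneg hS (norm_nonneg z)]
  exact integral_mono_of_nonneg (Eventually.of_forall fun z => by positivity)
    ((k2r_integrable_one_add_norm_pow_stdGaussian n).const_mul _) (Eventually.of_forall hpt)


/-! ## Registered sub-goal of `stub_pairGaussian` carried by this file -/

/-- **Registered sub-goal `stub_pairGaussian_moments`** (helper 1 of 3 of stub `stub_pairGaussian`, line birth of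
K2R): the quadratic projection moments of the local Maxwellian,
`∫ M_{1,θ,u}(w) (a + b ⟪w − u, ω⟫ + c ⟪w − u, ω⟫²) dw = a + c θ ‖ω‖²` — verbatim registered signature,
proved by `k2r_integral_localMaxwellian_mul_quadratic`. [folklore] -/
theorem stub_pairGaussian_moments : ∀ (θ : ℝ), 0 < θ → ∀ (u ω : EuclideanSpace ℝ (Fin 3)) (a b c : ℝ), (∫ w : EuclideanSpace ℝ (Fin 3), Literature.Analysis.FluidPDE.localMaxwellian 1 θ u w * (a + b * inner ℝ (w - u) ω + c * inner ℝ (w - u) ω ^ 2)) = a + c * θ * ‖ω‖ ^ 2 :=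
  fun _θ hθ u ω a b c => k2r_integral_localMaxwellian_mul_quadratic hθ u ω a b c

end Summit.AtomisticToContinuum.HydrodynamicLimit.Theorems.EnskogAdjointDuality

end
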